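import Literature.NumberTheory.EllipticCurves.PeriodIndexCorestrictionLocal
import Literature.NumberTheory.GaloisRepresentations.ContinuousCorestriction
import HarnessLib

/-!
# The double coset (Mackey) formula and «corestriction preserves local triviality» for ARBITRARY
# topological coefficients (`TopRep` currency): `res_φ ∘ cor_N^G = Σ_i cor^D_{φ⁻¹N} ∘ res_{φ|} ∘ (r_i)_*`

Topic `NumberTheory/GaloisRepresentations`; namespace `Literature.NumberTheory.GaloisRepresentations`.
Generic continuous group cohomology. The tree proves the Mackey formula for a NORMAL open subgroup `N ≤ G` of
finite index and a continuous homomorphism `φ : D →ₜ* G` in the DISCRETE-module currency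
(`PeriodIndexCorestrictionLocal`: `resH1Hom_coresH1_eq_sum`, `resH1Hom_coresH1_eq_zero`, on `discreteTopRep G M` built
from a `DistribMulAction`). This file is the SAME computation for an arbitrary topological representation
`X : TopRep R G` and the generic corestriction `cores X N hN` of `ContinuousCorestriction` (Mathlib
`ContinuousCohomology.map φ ψ 1` along a morphism `ψ : res_φ X ⟶ Y` of `D`-representations as the restriction):
needed whenever the coefficients are a twisted Galois module given as a `ContinuousRep` (no `DistribMulAction`
instance), e.g. Howard's `T_𝔮/p^k T_𝔮 = E[p^k] ⊗ A_{m,k}(ψ)` (`ZpExtension.eisensteinTwist`), for which the cell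
`pub/bsd-print-x9` needs «the corestriction of a class unramified at every place above `v` is unramified at `v`».
The group-theoretic half (orbit representatives `exists_orbitReps`, adapted sections `exists_adaptedSection`,
`comapRestrict`, `isOpen_comap`) is REUSED from `PeriodIndexCorestrictionLocal`; only the cocycle computation is redone.

* `resPairHom ψ N : res_{φ|} (X|_N) ⟶ Y|_{φ⁻¹N}` — the restricted compatible pair;
* `pullback_transferCocycle_eq_sum` — the Mackey formula on cocycles;
* **`map_cores_eq_sum`** — `H¹(φ, ψ) (cores θ) = Σ_i cores^D_{φ⁻¹N} (H¹(φ|, ψ) ((r i) · θ))` for a complete system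
  `r` of representatives of the `D`-orbits on `G ⧸ N` (for `G = Γ_K`, `N = Γ_L`, `D = Γ_{K_v}` or `Γ_{K_v^{ur}}`:
  `res_v ∘ cor_{L/K} = Σ_{w ∣ v} cor_w ∘ res_w`);
* **`map_cores_eq_zero`** — corestriction preserves local triviality: if every conjugate `g · θ` dies along
  `φ| : φ⁻¹N → N`, then `cores θ` dies along `φ`.

PROOFS (and two small definitions with bodies: the restricted pair); no named fact, no instance, no `sorry`.

## References
* J. Neukirch, A. Schmidt, K. Wingberg, *Cohomology of Number Fields*, 2nd ed. (2008), I §5 (1.5.6)–(1.5.7)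
  (double coset formula). [NeukirchSchmidtWingberg2008]
* J.-P. Serre, *Local Fields* (1979), VII §5–§7. [SerreLocalFields1979]
* P. L. Clark, S. Sharif, Algebra & Number Theory 4 (2010), §3.6 (local triviality of `cores`). [ClarkSharif2010]
-/

noncomputable section

open scoped Classical
open CategoryTheory Finset

universe u v

namespace Literature.NumberTheory.GaloisRepresentations

open Literature.NumberTheory.EllipticCurves (schreierElt schreierElt_coe rep_mul_schreierElt subgroupConj
  subgroupConj_apply_coe comapRestrict comapRestrict_apply_coe isOpen_comap exists_orbitReps exists_adaptedSection
  coe_smul_quotient_eq map_smul_quotient_eq)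

variable {R : Type v} [CommRing R] [TopologicalSpace R]
variable {G : Type u} [Group G] [TopologicalSpace G] [IsTopologicalGroup G]
variable {D : Type u} [Group D] [TopologicalSpace D] [IsTopologicalGroup D]
variable (X : TopRep.{u} R G) (Y : TopRep.{u} R D) (φ : D →ₜ* G)
  (ψ : TopRep.res (φ : D →* G) X ⟶ Y) (N : Subgroup G)

/-! ## The restricted compatible pair `(φ| : φ⁻¹N → N, ψ)` -/

/-- The coefficient morphism of the restricted pair: `ψ` regarded as a morphism
`res_{φ|} (X|_N) ⟶ Y|_{φ⁻¹N}` of topological representations of `φ⁻¹N` (equivariance: that of `ψ` on the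
subgroup). [cite: NeukirchSchmidtWingberg2008, I §5] -/
def resPairHom : TopRep.res (comapRestrict N φ : ↥(N.comap (φ : D →* G)) →* ↥N) (subgroupRep X N) ⟶
    subgroupRep Y (N.comap (φ : D →* G)) :=
  TopRep.ofHom ⟨ψ.hom.toContinuousLinearMap, fun h ↦ ψ.hom.isIntertwining' (h : D)⟩

omit [IsTopologicalGroup G] [IsTopologicalGroup D] in
/-- `resPairHom ψ N` is `ψ` on elements. [cite: NeukirchSchmidtWingberg2008, I §5] -/
@[simp] theorem resPairHom_hom_apply (x : X) : (resPairHom X Y φ ψ N).hom x = ψ.hom x := rfl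

omit [IsTopologicalGroup G] [IsTopologicalGroup D] in
/-- Equivariance of `ψ` in the `ρ`-form: `ψ (φ d • x) = d • ψ x`. [cite: NeukirchSchmidtWingberg2008, I §5] -/
theorem hom_ρ_apply (d : D) (x : X) : ψ.hom (X.ρ (φ d) x) = Y.ρ d (ψ.hom x) :=
  TopRep.hom_comm_apply ψ d x

/-- **`H¹(φ, ψ) : H¹(G, X) → H¹(D, Y)`** (Mathlib `ContinuousCohomology.map`) on explicit cocycles:
`[f] ↦ [ψ ∘ f ∘ φ]`. [cite: SerreLocalFields1979, VII §5] -/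
theorem map_pair_oneCocycleClass (f : contOneCocycles X) :
    ContinuousCohomology.map φ ψ 1 (oneCocycleClass X f) = oneCocycleClass Y (contOneCocycles.pullback φ ψ f) :=
  map_oneCocycleClass _ _ _ f

/-! ## The double coset formula on cocycles -/

section Mackey

variable [N.Normal] [Fintype (G ⧸ N)]

variable {X Y φ ψ N} in
/-- **The double coset formula on cocycles** (TopRep currency; verbatim the computation of
`PeriodIndexCorestrictionLocal.pullback_coresCocycle_eq_sum`): with representatives `s` of `G ⧸ N` adapted to the
orbit decomposition, the pull-back along `(φ, ψ)` of the transfer of `f` is the sum over the orbit representatives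
`r i` of the transfers, from `φ⁻¹N` to `D`, of the pull-backs along `(φ|, ψ)` of the conjugates `(r i) · f`.
[cite: NeukirchSchmidtWingberg2008, I §5 (1.5.6)–(1.5.7)] -/
theorem pullback_transferCocycle_eq_sum (hN : IsOpen (N : Set G)) [Fintype (D ⧸ N.comap (φ : D →* G))]
    {ι : Type*} [Fintype ι] {r : ι → G} {t : D ⧸ N.comap (φ : D →* G) → D}
    (ht : ∀ ē, (t ē : D ⧸ N.comap (φ : D →* G)) = ē)
    {e : ι × (D ⧸ N.comap (φ : D →* G)) ≃ G ⧸ N} {s : G ⧸ N → G} (hs : ∀ x, (s x : G ⧸ N) = x)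
    (hsd : ∀ (d : D) (i : ι) (ē : D ⧸ N.comap (φ : D →* G)), s (φ d • e (i, ē)) = φ (t (d • ē)) * r i)
    (f : contOneCocycles (subgroupRep X N)) :
    contOneCocycles.pullback φ ψ (transferCocycle X N hN hs f) =
      ∑ i, transferCocycle Y (N.comap (φ : D →* G)) (isOpen_comap N φ hN) ht
        (contOneCocycles.pullback (comapRestrict N φ) (resPairHom X Y φ ψ N)
          (contOneCocycles.pullback (subgroupConj N (r i)) (conjRepHom X N (r i)) f)) := by
  apply Subtype.ext
  ext d
  rw [contOneCocycles.pullback_apply, transferCocycle_apply, transferFun_apply, map_sum, sum_apply_val']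
  have hre : ∑ x : G ⧸ N, ψ.hom (X.ρ (s (φ d • x)) (f.1 (schreierElt N hs (φ d) x))) =
      ∑ q : ι × (D ⧸ N.comap (φ : D →* G)),
        ψ.hom (X.ρ (s (φ d • e q)) (f.1 (schreierElt N hs (φ d) (e q)))) :=
    (Equiv.sum_comp e (fun x ↦ ψ.hom (X.ρ (s (φ d • x)) (f.1 (schreierElt N hs (φ d) x))))).symm
  rw [hre, Fintype.sum_prod_type]
  refine Finset.sum_congr rfl fun i _ ↦ ?_
  rw [transferCocycle_apply, transferFun_apply]
  refine Finset.sum_congr rfl fun ē _ ↦ ?_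
  -- `s(e(i, ē)) = φ(t ē) r_i`
  have h1 : s (e (i, ē)) = φ (t ē) * r i := by
    have h := hsd 1 i ē
    rwa [map_one, one_smul, one_smul] at h
  -- the Schreier element of `G` at `(φ d, e(i, ē))` is `r_i⁻¹ φ(schreierElt_D d ē) r_i`
  have hS : schreierElt N hs (φ d) (e (i, ē)) = subgroupConj N (r i)
      (comapRestrict N φ (schreierElt (N.comap (φ : D →* G)) ht d ē)) := by
    apply Subtype.ext
    rw [schreierElt_coe, hsd, h1, subgroupConj_apply_coe, comapRestrict_apply_coe,
      schreierElt_coe, map_mul, map_mul, map_inv]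
    group
  rw [hS, contOneCocycles.pullback_apply, resPairHom_hom_apply, conj_pullback_apply, hsd, ρ_mul_apply, hom_ρ_apply]

/-- **The double coset (Mackey) formula for a normal open subgroup of finite index, arbitrary topological
coefficients.** For a continuous homomorphism `φ : D → G`, a morphism `ψ : res_φ X ⟶ Y` of topological
`D`-representations and a complete system `r : ι → G` of representatives of the `D`-orbits on `G ⧸ N` (the double
cosets `φ(D) \\ G / N`):
`H¹(φ, ψ) (cores^G_N θ) = Σ_i cores^D_{φ⁻¹N} (H¹(φ|, ψ) ((r i) · θ))` in `H¹(D, Y)`, where `(r i) · θ = conjMap X N (r i) 1 θ`.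
For `G = Γ_K`, `N = Γ_L`, `D = Γ_{K_v}`: `res_v ∘ cor_{L/K} = Σ_{w ∣ v} cor_{L_w/K_v} ∘ res_w`.
[cite: NeukirchSchmidtWingberg2008, I §5 (1.5.6)–(1.5.7)] [cite: SerreLocalFields1979, VII §5–§7] -/
theorem map_cores_eq_sum (hN : IsOpen (N : Set G)) [Fintype (D ⧸ N.comap (φ : D →* G))] {ι : Type*} [Fintype ι]
    (r : ι → G) (hr : ∀ x : G ⧸ N, ∃! i, ∃ d : D, φ d • (r i : G ⧸ N) = x)
    (θ : continuousCohomology 1 (subgroupRep X N)) :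
    ContinuousCohomology.map φ ψ 1 (cores X N hN θ) =
      ∑ i, cores Y (N.comap (φ : D →* G)) (isOpen_comap N φ hN)
        (ContinuousCohomology.map (comapRestrict N φ) (resPairHom X Y φ ψ N) 1 (conjMap X N (r i) 1 θ)) := by
  obtain ⟨f, rfl⟩ := oneCocycleClass_surjective _ θ
  have ht : ∀ ē : D ⧸ N.comap (φ : D →* G), ((Quotient.out ē : D) : D ⧸ N.comap (φ : D →* G)) = ē :=
    QuotientGroup.out_eq'
  obtain ⟨e, s, -, hs, hsd⟩ := exists_adaptedSection (N := N) (φ := φ) hr ht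
  rw [cores_oneCocycleClass X N hN hs, map_pair_oneCocycleClass,
    pullback_transferCocycle_eq_sum hN ht hs hsd f, ← oneCocycleClassₗ_apply, map_sum]
  refine Finset.sum_congr rfl fun i _ ↦ ?_
  rw [oneCocycleClassₗ_apply, conjMap_oneCocycleClass, map_oneCocycleClass, cores_oneCocycleClass _ _ _ ht]

/-- **Corestriction preserves local triviality, arbitrary topological coefficients** (Clark–Sharif 2010 §3.6:
"the corestriction map induces a homomorphism `⊕_{w ∣ v} H¹((K_P)_w, E) → H¹(K_v, E)`"). For a normal open
subgroup `N` of finite index, `φ : D →ₜ* G`, `ψ : res_φ X ⟶ Y` and `θ ∈ H¹(N, X)`: if `H¹(φ|, ψ) (g · θ) = 0` for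
every `g ∈ G` (`θ` dies on `φ⁻¹N` after every conjugation — «trivial at every place above `v`»), then
`H¹(φ, ψ) (cores θ) = 0` («`cores θ` is trivial at `v`»). [cite: ClarkSharif2010, §3.6 (last paragraph)]
[cite: NeukirchSchmidtWingberg2008, I §5 (1.5.6)–(1.5.7)] -/
theorem map_cores_eq_zero (hN : IsOpen (N : Set G)) [Fintype (D ⧸ N.comap (φ : D →* G))]
    (θ : continuousCohomology 1 (subgroupRep X N))
    (hθ : ∀ g : G, ContinuousCohomology.map (comapRestrict N φ) (resPairHom X Y φ ψ N) 1 (conjMap X N g 1 θ) = 0) :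
    ContinuousCohomology.map φ ψ 1 (cores X N hN θ) = 0 := by
  obtain ⟨ι, _, r, hr⟩ := exists_orbitReps N φ
  rw [map_cores_eq_sum X Y φ ψ N hN r hr θ]
  exact Finset.sum_eq_zero fun i _ ↦ by rw [hθ, map_zero]

/-- The same with any finiteness structure supplied from `Finite (G ⧸ N)` (`D ⧸ φ⁻¹N` is then finite,
`finite_quotientComap`). [cite: ClarkSharif2010, §3.6 (last paragraph)] -/
theorem map_cores_eq_zero' (hN : IsOpen (N : Set G)) (θ : continuousCohomology 1 (subgroupRep X N))
    (hθ : ∀ g : G, haveI : Fintype (D ⧸ N.comap (φ : D →* G)) :=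
        @Fintype.ofFinite _ (Literature.NumberTheory.EllipticCurves.finite_quotientComap N (φ : D →* G))
      ContinuousCohomology.map (comapRestrict N φ) (resPairHom X Y φ ψ N) 1 (conjMap X N g 1 θ) = 0) :
    ContinuousCohomology.map φ ψ 1 (cores X N hN θ) = 0 := by
  haveI : Fintype (D ⧸ N.comap (φ : D →* G)) :=
    @Fintype.ofFinite _ (Literature.NumberTheory.EllipticCurves.finite_quotientComap N (φ : D →* G))
  exact map_cores_eq_zero X Y φ ψ N hN θ hθ

end Mackey

end Literature.NumberTheory.GaloisRepresentations

end
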